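import Literature.Geometry.Symplectic.OpenBookTubeFrames
import Literature.Topology.FourManifolds.ClosedBallProofs
import Mathlib.Geometry.Manifold.LocalDiffeomorph
import HarnessLib

/-!
# Transport of open books, Giroux forms and supported plane fields along a diffeomorphism

Topic `Literature/Geometry/Symplectic`; an API file for the open books `OpenBook M` and Giroux
forms `OpenBook.IsGirouxForm` of `PlanarContactBoundary.lean`.  ONE definition (real, with body)
and its API, everything else PROVED; no named facts.

* `OpenBook.map ob Φ` — the open book `Φ_* ob` of `N'` obtained from an open book `ob` of `N`
  and a diffeomorphism `Φ : N ≃ N'`: tubes `Φ ∘ tube i`, fibration `π ∘ Φ⁻¹` (Etnyre 2006,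
  Def. 2.1: open books are transported by diffeomorphisms; this is how "the open book of `∂X`"
  is read on any abstract copy of the boundary); `map_binding : B(Φ_* ob) = Φ(B)`,
  `map_page : page_c(Φ_* ob) = Φ(page_c)`, `angularDeriv_map` (chain rule for `dθ`),
  `map_coreTangent`, `map_discFrame` (the core frame is pushed forward by `dΦ`).
* `OpenBook.IsGirouxForm.map` — if `α` is a Giroux form of `ob` for the plane field `ξ`, then the
  pulled-back form `(Φ⁻¹)^* α` is a Giroux form of `Φ_* ob` for the transported plane field
  `dΦ(ξ) = (dΦ⁻¹)⁻¹ ξ`; `OpenBook.Supports.map`; `OpenBook.IsPlanar.map`.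

Use: together with `OpenBook.IsGirouxForm.of_binding_eq_of_proj_eq`
(`OpenBookGirouxFormTransfer.lean`) this lets a statement about ALL open books with prescribed
binding and fibration on ALL abstract copies of a boundary `3`-manifold (e.g. the hypothesis
`IsKasOpenBookOf` of `Literature.Geometry.Symplectic.palf_stein_supportedByBoundaryOpenBook`) be
proved on one model.

## References

* J. B. Etnyre, *Lectures on open book decompositions and contact structures*, Clay Math. Proc.
  5 (2006), Def. 2.1, Def. 3.2. [Etnyre2006]
* F. W. Warner, *Foundations of Differentiable Manifolds and Lie Groups* (1983), 2.22–2.23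
  (pull-back of forms, naturality of `d`). [WarnerGTM94]
-/

noncomputable section

open scoped Manifold ContDiff Topology
open Set Function Filter
open Literature.Geometry.Kaehler Literature.Topology.FourManifolds

namespace Literature.Geometry.Symplectic

universe u v

variable {N : Type u} [TopologicalSpace N] [ChartedSpace (EuclideanSpace ℝ (Fin 3)) N]
  [IsManifold (𝓡 3) ∞ N]
  {N' : Type v} [TopologicalSpace N'] [ChartedSpace (EuclideanSpace ℝ (Fin 3)) N']
  [IsManifold (𝓡 3) ∞ N']

/-! ### The angular differential under composition -/

omit [IsManifold (𝓡 3) ∞ N] [IsManifold (𝓡 3) ∞ N'] in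
/-- **Chain rule for `dθ`**: `d(θ ∘ f)_y = dθ_{f y} ∘ df_y`. [folklore] -/
theorem angularDeriv_comp {θ : N → Metric.sphere (0 : EuclideanSpace ℝ (Fin 2)) 1} {f : N' → N}
    {y : N'} (hθ : MDifferentiableAt (𝓡 3) 𝓘(ℝ, EuclideanSpace ℝ (Fin 2))
      (fun z => (θ z : EuclideanSpace ℝ (Fin 2))) (f y))
    (hf : MDifferentiableAt (𝓡 3) (𝓡 3) f y) :
    angularDeriv (θ ∘ f) y = (angularDeriv θ (f y)).comp (mfderiv (𝓡 3) (𝓡 3) f y) := by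
  unfold angularDeriv
  have hc : (fun z => ((θ ∘ f) z : EuclideanSpace ℝ (Fin 2))) =
      (fun z => (θ z : EuclideanSpace ℝ (Fin 2))) ∘ f := rfl
  rw [hc, mfderiv_comp y hθ hf]
  rfl

omit [TopologicalSpace N] [ChartedSpace (EuclideanSpace ℝ (Fin 3)) N] [IsManifold (𝓡 3) ∞ N]
  [TopologicalSpace N'] [ChartedSpace (EuclideanSpace ℝ (Fin 3)) N'] [IsManifold (𝓡 3) ∞ N'] in
/-- The tubes-binding of the composed tubes `Φ ∘ tube i` is the image of the tubes-binding.
[folklore] -/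
theorem tubesBinding_comp {k : ℕ}
    (tube : Fin k → (Metric.sphere (0 : EuclideanSpace ℝ (Fin 2)) 1) × EuclideanSpace ℝ (Fin 2) → N)
    (Φ : N → N') : tubesBinding (fun i => Φ ∘ tube i) = Φ '' tubesBinding tube := by
  ext y
  simp only [mem_tubesBinding_iff, comp_apply, mem_image]
  constructor
  · rintro ⟨i, x, rfl⟩
    exact ⟨_, ⟨i, x, rfl⟩, rfl⟩
  · rintro ⟨_, ⟨i, x, rfl⟩, rfl⟩
    exact ⟨i, x, rfl⟩

namespace OpenBook

/-- The fibration of an open book, read in `ℝ²`, is differentiable off the binding. [folklore] -/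
theorem mdifferentiableAt_coe_proj [T2Space N] (ob : OpenBook N) {x : N} (hx : x ∉ ob.binding) :
    MDifferentiableAt (𝓡 3) 𝓘(ℝ, EuclideanSpace ℝ (Fin 2))
      (fun z => (ob.proj z : EuclideanSpace ℝ (Fin 2))) x := by
  haveI : Fact (Module.finrank ℝ (EuclideanSpace ℝ (Fin 2)) = 1 + 1) := ⟨by simp⟩
  have h1 : ContMDiffAt (𝓡 3) (𝓡 1) ∞ ob.proj x :=
    ob.contMDiffOn_proj.contMDiffAt (ob.isOpen_compl_binding.mem_nhds hx)
  exact ((contMDiff_coe_sphere (n := 1) (m := ∞)).contMDiffAt.comp x h1).mdifferentiableAt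
    (by simp)

/-! ### Transport of an open book along a diffeomorphism -/

/-- **The open book `Φ_* ob` transported along a diffeomorphism `Φ : N ≃ N'`**: tubes
`Φ ∘ tube i`, fibration `π ∘ Φ⁻¹` (so binding `Φ(B)` and pages `Φ(page)`).  The axioms transfer:
a smooth embedding followed by a diffeomorphism is a smooth embedding with open image, the normal
form `π (tube (x, w)) = w/‖w‖` is read through `Φ⁻¹ ∘ Φ = id`, and `dθ ∘ dΦ⁻¹ ≠ 0` since `dΦ⁻¹`
is onto. [cite: Etnyre2006, Def. 2.1] -/
def map [T2Space N] (ob : OpenBook N) (Φ : N ≃ₘ⟮𝓡 3, 𝓡 3⟯ N') : OpenBook N' where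
  k := ob.k
  k_pos := ob.k_pos
  tube i := Φ ∘ ob.tube i
  proj := ob.proj ∘ Φ.symm
  isSmoothEmbedding_tube i := (ob.isSmoothEmbedding_tube i).diffeomorph_comp Φ
  isOpen_range_tube i := by
    rw [range_comp]
    exact Φ.toHomeomorph.isOpenMap _ (ob.isOpen_range_tube i)
  eq_zero_of_tube_eq i j x y w h := ob.eq_zero_of_tube_eq i j x y w (Φ.injective h)
  proj_tube i x w hw := by
    simp only [comp_apply, Diffeomorph.symm_apply_apply]
    exact ob.proj_tube i x w hw
  contMDiffOn_proj := by
    rw [tubesBinding_comp]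
    refine ob.contMDiffOn_proj.comp Φ.symm.contMDiff.contMDiffOn fun y hy hy' => hy ?_
    exact ⟨Φ.symm y, hy', Φ.apply_symm_apply y⟩
  angularDeriv_ne_zero y hy := by
    rw [tubesBinding_comp] at hy
    have hx : Φ.symm y ∉ ob.binding := fun hx => hy ⟨Φ.symm y, hx, Φ.apply_symm_apply y⟩
    have hne := ob.angularDeriv_ne_zero (Φ.symm y) hx
    rw [angularDeriv_comp (ob.mdifferentiableAt_coe_proj hx)
      (Φ.symm.contMDiff.mdifferentiableAt (by simp))]
    intro h0
    apply hne
    ext v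
    obtain ⟨u, rfl⟩ := (Φ.symm.mfderivToContinuousLinearEquiv (by simp) y).surjective v
    exact DFunLike.congr_fun h0 u

variable [T2Space N] (ob : OpenBook N) (Φ : N ≃ₘ⟮𝓡 3, 𝓡 3⟯ N')

/-- The transported open book has the same number of tubes. [folklore] -/
@[simp] theorem map_k : (ob.map Φ).k = ob.k := rfl

/-- The tubes of the transported open book are `Φ ∘ tube i`. [folklore] -/
@[simp] theorem map_tube (i : Fin ob.k) : (ob.map Φ).tube i = Φ ∘ ob.tube i := rfl

/-- The fibration of the transported open book is `π ∘ Φ⁻¹`. [folklore] -/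
@[simp] theorem map_proj : (ob.map Φ).proj = ob.proj ∘ Φ.symm := rfl

/-- **The binding of `Φ_* ob` is `Φ(B)`.** [cite: Etnyre2006, Def. 2.1] -/
theorem map_binding : (ob.map Φ).binding = Φ '' ob.binding :=
  tubesBinding_comp ob.tube Φ

/-- `y` lies in the binding of `Φ_* ob` iff `Φ⁻¹ y` lies in the binding of `ob`. [folklore] -/
theorem mem_map_binding_iff (y : N') : y ∈ (ob.map Φ).binding ↔ Φ.symm y ∈ ob.binding := by
  rw [map_binding]
  constructor
  · rintro ⟨x, hx, rfl⟩
    rwa [Φ.symm_apply_apply]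
  · intro h
    exact ⟨Φ.symm y, h, Φ.apply_symm_apply y⟩

/-- **The pages of `Φ_* ob` are the images `Φ(page)`.** [cite: Etnyre2006, Def. 2.1] -/
theorem map_page (c : Metric.sphere (0 : EuclideanSpace ℝ (Fin 2)) 1) :
    (ob.map Φ).page c = Φ '' ob.page c := by
  ext y
  simp only [mem_page_iff, mem_map_binding_iff, map_proj, comp_apply, mem_image]
  constructor
  · rintro ⟨h1, h2⟩
    exact ⟨Φ.symm y, ⟨h1, h2⟩, Φ.apply_symm_apply y⟩
  · rintro ⟨x, ⟨h1, h2⟩, rfl⟩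
    rw [Φ.symm_apply_apply]
    exact ⟨h1, h2⟩

/-- **Chain rule for the fibration of `Φ_* ob`**: `dθ'_y = dθ_{Φ⁻¹ y} ∘ dΦ⁻¹_y` off the binding.
[folklore] -/
theorem angularDeriv_map {y : N'} (hy : Φ.symm y ∉ ob.binding) :
    angularDeriv (ob.map Φ).proj y =
      (angularDeriv ob.proj (Φ.symm y)).comp (mfderiv (𝓡 3) (𝓡 3) Φ.symm y) := by
  rw [map_proj]
  exact angularDeriv_comp (ob.mdifferentiableAt_coe_proj hy)
    (Φ.symm.contMDiff.mdifferentiableAt (by simp))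

/-- The differential of a transported tube: `d(Φ ∘ tube i) = dΦ ∘ d(tube i)`. [folklore] -/
theorem mfderiv_map_tube (i : Fin ob.k)
    (q : (Metric.sphere (0 : EuclideanSpace ℝ (Fin 2)) 1) × EuclideanSpace ℝ (Fin 2))
    (v : TangentSpace ((𝓡 1).prod 𝓘(ℝ, EuclideanSpace ℝ (Fin 2))) q) :
    mfderiv ((𝓡 1).prod 𝓘(ℝ, EuclideanSpace ℝ (Fin 2))) (𝓡 3) ((ob.map Φ).tube i) q v =
      mfderiv (𝓡 3) (𝓡 3) Φ (ob.tube i q)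
        (mfderiv ((𝓡 1).prod 𝓘(ℝ, EuclideanSpace ℝ (Fin 2))) (𝓡 3) (ob.tube i) q v) := by
  have h := mfderiv_comp q (Φ.contMDiff.mdifferentiableAt (by simp))
    (((ob.isSmoothEmbedding_tube i).contMDiff q).mdifferentiableAt (by simp))
  exact DFunLike.congr_fun h v

/-- **The binding tangent of `Φ_* ob` is `dΦ(b)`.** [folklore] -/
theorem map_coreTangent (i : Fin ob.k) (x : Metric.sphere (0 : EuclideanSpace ℝ (Fin 2)) 1) :
    (ob.map Φ).coreTangent i x =
      mfderiv (𝓡 3) (𝓡 3) Φ (ob.tube i (x, 0)) (ob.coreTangent i x) :=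
  ob.mfderiv_map_tube Φ i (x, 0) _

/-- **The meridional frame of `Φ_* ob` is `dΦ(e₁, e₂)`.** [folklore] -/
theorem map_discFrame (i : Fin ob.k) (x : Metric.sphere (0 : EuclideanSpace ℝ (Fin 2)) 1)
    (j : Fin 2) :
    (ob.map Φ).discFrame i x j =
      mfderiv (𝓡 3) (𝓡 3) Φ (ob.tube i (x, 0)) (ob.discFrame i x j) :=
  ob.mfderiv_map_tube Φ i (x, 0) _

/-- `dΦ⁻¹ ∘ d(Φ ∘ tube i) = d(tube i)`: the pull-back along `Φ⁻¹` undoes the push-forward of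
the tube frame. [folklore] -/
theorem mfderiv_symm_mfderiv_map_tube (i : Fin ob.k)
    (q : (Metric.sphere (0 : EuclideanSpace ℝ (Fin 2)) 1) × EuclideanSpace ℝ (Fin 2))
    (v : TangentSpace ((𝓡 1).prod 𝓘(ℝ, EuclideanSpace ℝ (Fin 2))) q) :
    mfderiv (𝓡 3) (𝓡 3) Φ.symm ((ob.map Φ).tube i q)
        (mfderiv ((𝓡 1).prod 𝓘(ℝ, EuclideanSpace ℝ (Fin 2))) (𝓡 3) ((ob.map Φ).tube i) q v) =
      mfderiv ((𝓡 1).prod 𝓘(ℝ, EuclideanSpace ℝ (Fin 2))) (𝓡 3) (ob.tube i) q v := by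
  have h := mfderiv_comp q (Φ.symm.contMDiff.mdifferentiableAt (by simp))
    ((((ob.isSmoothEmbedding_tube i).diffeomorph_comp Φ).contMDiff q).mdifferentiableAt
      (by simp))
  have hcomp : (Φ.symm : N' → N) ∘ ((Φ : N → N') ∘ ob.tube i) = ob.tube i :=
    funext fun z => Φ.symm_apply_apply (ob.tube i z)
  rw [hcomp] at h
  exact (DFunLike.congr_fun h v).symm

/-- `dΦ⁻¹(b') = b` for the binding tangent `b' = dΦ(b)` of `Φ_* ob`. [folklore] -/
theorem mfderiv_symm_map_coreTangent (i : Fin ob.k)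
    (x : Metric.sphere (0 : EuclideanSpace ℝ (Fin 2)) 1) :
    mfderiv (𝓡 3) (𝓡 3) Φ.symm ((ob.map Φ).tube i (x, 0)) ((ob.map Φ).coreTangent i x) =
      ob.coreTangent i x :=
  ob.mfderiv_symm_mfderiv_map_tube Φ i (x, 0) _

/-- `dΦ⁻¹(eⱼ') = eⱼ` for the meridional frame `eⱼ' = dΦ(eⱼ)` of `Φ_* ob`. [folklore] -/
theorem mfderiv_symm_map_discFrame (i : Fin ob.k)
    (x : Metric.sphere (0 : EuclideanSpace ℝ (Fin 2)) 1) (j : Fin 2) :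
    mfderiv (𝓡 3) (𝓡 3) Φ.symm ((ob.map Φ).tube i (x, 0)) ((ob.map Φ).discFrame i x j) =
      ob.discFrame i x j :=
  ob.mfderiv_symm_mfderiv_map_tube Φ i (x, 0) _

/-! ### Transport of Giroux forms -/

omit [IsManifold (𝓡 3) ∞ N] [IsManifold (𝓡 3) ∞ N'] [T2Space N] in
/-- Evaluation of a pulled-back `1`-form on one vector. [folklore] -/
theorem pullback_apply_one (α : MForm (𝓡 3) N ℝ 1) (f : N' → N) (y : N')
    (v : EuclideanSpace ℝ (Fin 3)) :
    α.pullback (𝓡 3) f y ![v] = α (f y) ![mfderiv (𝓡 3) (𝓡 3) f y v] := by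
  rw [MForm.pullback_apply]
  congr 1
  funext i
  fin_cases i
  rfl

omit [IsManifold (𝓡 3) ∞ N] [IsManifold (𝓡 3) ∞ N'] [T2Space N] in
/-- Evaluation of a pulled-back `2`-form on two vectors. [folklore] -/
theorem pullback_apply_two (β : MForm (𝓡 3) N ℝ 2) (f : N' → N) (y : N')
    (u v : EuclideanSpace ℝ (Fin 3)) :
    β.pullback (𝓡 3) f y ![u, v] =
      β (f y) ![mfderiv (𝓡 3) (𝓡 3) f y u, mfderiv (𝓡 3) (𝓡 3) f y v] := by
  rw [MForm.pullback_apply]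
  congr 1
  funext i
  fin_cases i <;> rfl

omit [T2Space N] in
/-- **The wedge `α ∧ dα` of a pulled-back form**: for a smooth `α` and the diffeomorphism
`Φ⁻¹`, `((Φ⁻¹)^*α ∧ d(Φ⁻¹)^*α)_y(u, v, w) = (α ∧ dα)_{Φ⁻¹ y}(dΦ⁻¹ u, dΦ⁻¹ v, dΦ⁻¹ w)`
(naturality of `d`, `mextDeriv_pullback_apply`). [cite: WarnerGTM94, Prop. 2.23] -/
theorem wedge₁₂_pullback_symm {α : MForm (𝓡 3) N ℝ 1} (hα : IsSmoothForm α) (y : N')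
    (u v w : EuclideanSpace ℝ (Fin 3)) :
    wedge₁₂ (α.pullback (𝓡 3) Φ.symm y) (mextDeriv (α.pullback (𝓡 3) Φ.symm) y) u v w =
      wedge₁₂ (α (Φ.symm y)) (mextDeriv α (Φ.symm y)) (mfderiv (𝓡 3) (𝓡 3) Φ.symm y u)
        (mfderiv (𝓡 3) (𝓡 3) Φ.symm y v) (mfderiv (𝓡 3) (𝓡 3) Φ.symm y w) := by
  rw [mextDeriv_pullback_apply (Eventually.of_forall fun z => Φ.symm.contMDiff.contMDiffAt)
    (hα _)]
  exact wedge₁₂_compContinuousLinearMap _ _ _ u v w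

omit [T2Space N] in
/-- `dα` of a pulled-back form on two vectors: `d((Φ⁻¹)^*α)_y(u, v) = dα_{Φ⁻¹ y}(dΦ⁻¹u, dΦ⁻¹v)`.
[cite: WarnerGTM94, Prop. 2.23] -/
theorem mextDeriv_pullback_symm_apply_two {α : MForm (𝓡 3) N ℝ 1} (hα : IsSmoothForm α) (y : N')
    (u v : EuclideanSpace ℝ (Fin 3)) :
    mextDeriv (α.pullback (𝓡 3) Φ.symm) y ![u, v] =
      mextDeriv α (Φ.symm y) ![mfderiv (𝓡 3) (𝓡 3) Φ.symm y u, mfderiv (𝓡 3) (𝓡 3) Φ.symm y v] := by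
  rw [mextDeriv_pullback_apply (Eventually.of_forall fun z => Φ.symm.contMDiff.contMDiffAt)
    (hα _)]
  exact pullback_apply_two _ _ _ u v

/-- **Giroux forms are transported by diffeomorphisms.**  If `α` is a Giroux form of the open
book `ob` of `N` for the plane field `ξ`, and `Φ : N ≃ N'` is a diffeomorphism, then
`(Φ⁻¹)^* α` is a Giroux form of `Φ_* ob` for the transported plane field
`y ↦ (dΦ⁻¹_y)⁻¹ ξ_{Φ⁻¹ y}`: all five conditions are read through `dΦ⁻¹`, an isomorphism
(`ker`, the contact condition), the chain rule for `dθ` (pages) and `dΦ⁻¹ ∘ d(Φ ∘ tube) = d tube`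
(binding). [cite: Etnyre2006, Def. 3.2] -/
theorem IsGirouxForm.map {ξ : N → Submodule ℝ (EuclideanSpace ℝ (Fin 3))}
    {α : MForm (𝓡 3) N ℝ 1} (h : ob.IsGirouxForm ξ α) :
    (ob.map Φ).IsGirouxForm
      (fun y => (ξ (Φ.symm y)).comap (mfderiv (𝓡 3) (𝓡 3) Φ.symm y).toLinearMap)
      (α.pullback (𝓡 3) Φ.symm) where
  smooth y := MForm.SmoothAt.pullback
    (Eventually.of_forall fun z => Φ.symm.contMDiff.contMDiffAt) (h.smooth (Φ.symm y))
  ker_eq y v := by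
    rw [pullback_apply_one, h.ker_eq, Submodule.mem_comap]
    rfl
  contact y := by
    obtain ⟨u, v, w, huvw⟩ := h.contact (Φ.symm y)
    set D := Φ.symm.mfderivToContinuousLinearEquiv (by simp) y with hD
    refine ⟨D.symm u, D.symm v, D.symm w, ?_⟩
    rw [wedge₁₂_pullback_symm Φ h.smooth]
    have hc : ∀ z, mfderiv (𝓡 3) (𝓡 3) Φ.symm y (D.symm z) = z := fun z =>
      D.apply_symm_apply z
    rw [hc, hc, hc]
    exact huvw
  pages y hy n u v hn hu hv := by
    have hx : Φ.symm y ∉ ob.binding := fun hx => hy ((ob.mem_map_binding_iff Φ y).2 hx)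
    rw [ob.angularDeriv_map Φ hx] at hn hu hv
    rw [wedge₁₂_pullback_symm Φ h.smooth, mextDeriv_pullback_symm_apply_two Φ h.smooth]
    exact h.pages (Φ.symm y) hx (mfderiv (𝓡 3) (𝓡 3) Φ.symm y n)
      (mfderiv (𝓡 3) (𝓡 3) Φ.symm y u) (mfderiv (𝓡 3) (𝓡 3) Φ.symm y v) hn hu hv
  binding i x := by
    rw [wedge₁₂_pullback_symm Φ h.smooth, pullback_apply_one, mfderiv_symm_map_coreTangent,
      mfderiv_symm_map_discFrame, mfderiv_symm_map_discFrame]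
    have key : ∀ z : N, z = ob.tube i (x, 0) →
        0 < α z ![ob.coreTangent i x] * wedge₁₂ (α z) (mextDeriv α z) (ob.coreTangent i x)
          (ob.discFrame i x 0) (ob.discFrame i x 1) := by
      rintro z rfl
      exact h.binding i x
    exact key _ (Φ.symm_apply_apply _)

/-- **Supported plane fields are transported by diffeomorphisms.** [cite: Etnyre2006, Def. 3.2] -/
theorem Supports.map {ξ : N → Submodule ℝ (EuclideanSpace ℝ (Fin 3))} (h : ob.Supports ξ) :
    (ob.map Φ).Supports
      fun y => (ξ (Φ.symm y)).comap (mfderiv (𝓡 3) (𝓡 3) Φ.symm y).toLinearMap := by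
  obtain ⟨α, hα⟩ := h
  exact ⟨_, hα.map ob Φ⟩

/-- **Planarity is transported by diffeomorphisms** (the pages of `Φ_* ob` are homeomorphic
images of the pages of `ob`). [cite: Wendl2020, §5.2 p. 82] -/
theorem IsPlanar.map (h : ob.IsPlanar) : (ob.map Φ).IsPlanar := by
  intro c
  obtain ⟨f, hf, hinj⟩ := h c
  have hmaps : ∀ y, y ∈ (ob.map Φ).page c → Φ.symm y ∈ ob.page c := by
    intro y hy
    rw [map_page] at hy
    obtain ⟨x, hx, rfl⟩ := hy
    rwa [Φ.symm_apply_apply]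
  exact ⟨f ∘ Subtype.map Φ.symm hmaps, hf.comp (Φ.symm.continuous.subtype_map hmaps),
    hinj.comp (Subtype.map_injective hmaps Φ.symm.injective)⟩

end OpenBook

end Literature.Geometry.Symplectic
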